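import Mathlib

/-!
# Continuity of the twisted difference map (step T2b)

Crux `WitnessCharge` (stmt-SmoothPoincare4-7824), route `SullivanDual`, line Sketch. For a map
`h : ℂ → F` into a real normed space carrying a field of operators `J`, the twisted difference
map is
`T (z, w) = (‖z - w‖ ^ 2)⁻¹ • (Re (z - w) • (h z - h w) - Im (z - w) • J (h w) (h z - h w))`
off the diagonal and `dh_w 1` on it. This file shows that `T` is continuous on `S ×ˢ S` when
`S` is a compact convex subset of an open set `U` on which `h` is `C¹`, `J` is continuous on an
open set `O ⊇ h '' S`, and `h` is `J`-holomorphic at the points of `S`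
(`dh_w (I * α) = J (h w) (dh_w α)`).

Proof. Off the diagonal the defining formula is visibly continuous. At a diagonal point
`(w₀, w₀)` one uses the identity (valid for `z ≠ w`, `w ∈ S`, with `L := dh_w`, `v := L 1`,
`J₀ := J (h w)` and `E := h z - h w - L (z - w)`)
`T (z, w) - v = (‖z - w‖ ^ 2)⁻¹ • (Re (z - w) • E - Im (z - w) • J₀ E)`,
which follows from `L (z - w) = Re (z - w) • v + Im (z - w) • J₀ v` and `J₀ (J₀ v) = -v` (both
consequences of `J`-holomorphicity with `α = 1` and `α = I`). The mean value inequality on the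
segment `[w, z] ⊆ S` bounds `‖E‖` by `ε₁ ‖z - w‖` once `dh` varies by at most `ε₁` on the
segment (uniform continuity of `dh` on the compact `S`), whence
`‖T (z, w) - v‖ ≤ (1 + ‖J₀‖) ε₁`; together with the continuity of `w ↦ dh_w 1` and a local
bound on `‖J (h w)‖` this gives continuity at `(w₀, w₀)`.

Mathlib only; no definitions, no `sorry`.
-/

noncomputable section

-- the summit path `SmoothPoincare4/SmoothPoincare4` forces a duplicated namespace segment
set_option linter.dupNamespace false

open Set Filter Metric Function Topology

namespace Summit.SmoothPoincare4.SmoothPoincare4.Theorems.WitnessCharge.PencilIncompleteness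

/-- Algebraic identity behind the diagonal estimate: if `L I = J₀ (L 1)` and
`J₀ (J₀ (L 1)) = -L 1`, then for `u ≠ 0` the twisted difference quotient built from `Δ` differs
from `L 1` by the twisted difference quotient built from `Δ - L u`. -/
theorem helper_tdiff_continuousOn_identity
    {F : Type*} [NormedAddCommGroup F] [NormedSpace ℝ F] (J₀ : F →L[ℝ] F) (L : ℂ →L[ℝ] F)
    (u : ℂ) (Δ : F) (hu : u ≠ 0) (hI : L Complex.I = J₀ (L 1))
    (hII : J₀ (J₀ (L 1)) = -L 1) :
    (‖u‖ ^ 2)⁻¹ • (u.re • Δ - u.im • J₀ Δ) - L 1 =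
      (‖u‖ ^ 2)⁻¹ • (u.re • (Δ - L u) - u.im • J₀ (Δ - L u)) := by
  -- decompose `L u` along the real basis `1, I`
  have hu' : u = u.re • (1 : ℂ) + u.im • Complex.I := Complex.ext (by simp) (by simp)
  have hLu : L u = u.re • L 1 + u.im • J₀ (L 1) := by
    rw [← hI]
    conv_lhs => rw [hu']
    rw [map_add, map_smul, map_smul]
  have hN : ‖u‖ ^ 2 ≠ 0 := pow_ne_zero _ (norm_ne_zero_iff.mpr hu)
  have hsq : ‖u‖ ^ 2 = u.re * u.re + u.im * u.im := by
    rw [Complex.sq_norm, Complex.normSq_apply]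
  -- the twisted combination of `L u` is `‖u‖ ^ 2 • L 1`
  have key : u.re • L u - u.im • J₀ (L u) = (‖u‖ ^ 2) • L 1 := by
    rw [hLu, map_add, map_smul, map_smul, hII, hsq]
    module
  symm
  calc (‖u‖ ^ 2)⁻¹ • (u.re • (Δ - L u) - u.im • J₀ (Δ - L u))
      = (‖u‖ ^ 2)⁻¹ • ((u.re • Δ - u.im • J₀ Δ) - (u.re • L u - u.im • J₀ (L u))) := by
        rw [map_sub]; congr 1; module
    _ = (‖u‖ ^ 2)⁻¹ • (u.re • Δ - u.im • J₀ Δ) - L 1 := by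
        rw [key, smul_sub, smul_smul, inv_mul_cancel₀ hN, one_smul]

/-- Norm bound behind the diagonal estimate: if `‖E‖ ≤ C ‖u‖` and `u ≠ 0`, then the twisted
difference quotient built from `E` has norm at most `(1 + ‖J₀‖) C`. -/
theorem helper_tdiff_continuousOn_bound
    {F : Type*} [NormedAddCommGroup F] [NormedSpace ℝ F] (J₀ : F →L[ℝ] F) (u : ℂ) (E : F)
    (C : ℝ) (hu : u ≠ 0) (hE : ‖E‖ ≤ C * ‖u‖) :
    ‖(‖u‖ ^ 2)⁻¹ • (u.re • E - u.im • J₀ E)‖ ≤ (1 + ‖J₀‖) * C := by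
  have hu' : 0 < ‖u‖ := norm_pos_iff.mpr hu
  have hN : 0 < ‖u‖ ^ 2 := by positivity
  rw [norm_smul, norm_inv, norm_pow, norm_norm, inv_mul_le_iff₀ hN]
  calc ‖u.re • E - u.im • J₀ E‖ ≤ ‖u.re • E‖ + ‖u.im • J₀ E‖ := norm_sub_le _ _
    _ = |u.re| * ‖E‖ + |u.im| * ‖J₀ E‖ := by
        rw [norm_smul, norm_smul, Real.norm_eq_abs, Real.norm_eq_abs]
    _ ≤ ‖u‖ * ‖E‖ + ‖u‖ * (‖J₀‖ * ‖E‖) := by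
        gcongr
        exacts [Complex.abs_re_le_norm u, Complex.abs_im_le_norm u, J₀.le_opNorm E]
    _ = ‖u‖ * (1 + ‖J₀‖) * ‖E‖ := by ring
    _ ≤ ‖u‖ * (1 + ‖J₀‖) * (C * ‖u‖) := by gcongr
    _ = ‖u‖ ^ 2 * ((1 + ‖J₀‖) * C) := by ring

/-- **T2b — continuity of the twisted difference map on `S ×ˢ S`.**
For a `C¹` map `h` on an open set `U ⊇ S` (`S` compact and convex) with values in an open set
`O` on which the operator field `J` is continuous, `J`-holomorphic at the points of `S`, the
twisted difference map `T` (extended by `dh_w 1` on the diagonal) is continuous on `S ×ˢ S`. -/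
theorem helper_tdiff_continuousOn :
    ∀ (F : Type) [NormedAddCommGroup F] [NormedSpace ℝ F] (J : F → F →L[ℝ] F) (O : Set F)
      (h : ℂ → F) (U S : Set ℂ) (T : ℂ × ℂ → F),
      IsOpen O → ContinuousOn J O → IsOpen U → IsCompact S → Convex ℝ S → S ⊆ U →
      ContDiffOn ℝ 1 h U → Set.MapsTo h S O →
      (∀ w ∈ S, ∀ α : ℂ, fderiv ℝ h w (Complex.I * α) = J (h w) (fderiv ℝ h w α)) →
      (∀ z w : ℂ, T (z, w) = if z = w then fderiv ℝ h w 1 else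
        (‖z - w‖ ^ 2)⁻¹ • ((z - w).re • (h z - h w) - (z - w).im • J (h w) (h z - h w))) →
      ContinuousOn T (S ×ˢ S) := by
  intro F _ _ J O h U S T _hO hJ hU hS hSc hSU hh hhO hJh hT
  -- basic regularity of `h` on `S`
  have hcont : ContinuousOn h S := hh.continuousOn.mono hSU
  have hdiff : ∀ x ∈ U, DifferentiableAt ℝ h x := fun x hx =>
    (hh.differentiableOn one_ne_zero).differentiableAt (hU.mem_nhds hx)
  have hfd : ContinuousOn (fderiv ℝ h) S := (hh.continuousOn_fderiv_of_isOpen hU le_rfl).mono hSU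
  rintro ⟨z₀, w₀⟩ hp
  obtain ⟨hz₀, hw₀⟩ := Set.mem_prod.mp hp
  by_cases hne : z₀ ≠ w₀
  · /- Off the diagonal: `T` agrees with the defining formula on the open set `{p | p.1 ≠ p.2}`,
    and the formula is continuous on `(S ×ˢ S) ∩ {p | p.1 ≠ p.2}`. -/
    set D : Set (ℂ × ℂ) := {p | p.1 ≠ p.2} with hD_def
    have hD : IsOpen D := isOpen_ne_fun continuous_fst continuous_snd
    set S' : Set (ℂ × ℂ) := (S ×ˢ S) ∩ D with hS'_def
    have h1 : ContinuousOn (fun p : ℂ × ℂ => h p.1) S' :=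
      hcont.comp continuousOn_fst fun p hp => (Set.mem_prod.mp hp.1).1
    have h2 : ContinuousOn (fun p : ℂ × ℂ => h p.2) S' :=
      hcont.comp continuousOn_snd fun p hp => (Set.mem_prod.mp hp.1).2
    have h3 : ContinuousOn (fun p : ℂ × ℂ => J (h p.2)) S' :=
      hJ.comp h2 fun p hp => hhO (Set.mem_prod.mp hp.1).2
    have h4 : ContinuousOn (fun p : ℂ × ℂ => p.1 - p.2) S' :=
      (continuous_fst.sub continuous_snd).continuousOn
    have h5 : ContinuousOn (fun p : ℂ × ℂ => (‖p.1 - p.2‖ ^ 2)⁻¹) S' :=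
      (h4.norm.pow 2).inv₀ fun p hp =>
        pow_ne_zero _ (norm_ne_zero_iff.mpr (sub_ne_zero.mpr hp.2))
    have h6 : ContinuousOn (fun p : ℂ × ℂ => (p.1 - p.2).re) S' :=
      Complex.continuous_re.comp_continuousOn h4
    have h7 : ContinuousOn (fun p : ℂ × ℂ => (p.1 - p.2).im) S' :=
      Complex.continuous_im.comp_continuousOn h4
    have hG : ContinuousOn (fun p : ℂ × ℂ => (‖p.1 - p.2‖ ^ 2)⁻¹ •
        ((p.1 - p.2).re • (h p.1 - h p.2) - (p.1 - p.2).im • J (h p.2) (h p.1 - h p.2))) S' :=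
      h5.smul ((h6.smul (h1.sub h2)).sub (h7.smul (h3.clm_apply (h1.sub h2))))
    have hTS' : ContinuousOn T S' := by
      refine hG.congr ?_
      rintro ⟨z, w⟩ hq
      exact (hT z w).trans (if_neg hq.2)
    exact (continuousWithinAt_inter (hD.mem_nhds hne)).mp (hTS' (z₀, w₀) ⟨hp, hne⟩)
  · /- On the diagonal: an `ε`-`δ` argument based on the two helper lemmas above. -/
    obtain rfl : z₀ = w₀ := not_ne_iff.mp hne
    rw [Metric.continuousWithinAt_iff]
    intro ε hε
    -- a local bound `M` for `‖J (h w)‖`, `w ∈ S` near `z₀`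
    set M : ℝ := ‖J (h z₀)‖ + 1 with hM_def
    have hM : 0 < M := by positivity
    have hJc : ContinuousWithinAt (fun w => J (h w)) S z₀ := (hJ.comp hcont hhO) z₀ hz₀
    obtain ⟨δ₂, hδ₂, hJb⟩ : ∃ δ₂ > 0, ∀ w ∈ S, dist w z₀ < δ₂ → ‖J (h w)‖ ≤ M := by
      obtain ⟨δ₂, hδ₂, hδ⟩ := Metric.continuousWithinAt_iff.mp hJc 1 one_pos
      exact ⟨δ₂, hδ₂, fun w hw hd => (norm_lt_of_mem_ball (hδ hw hd)).le⟩
    -- the auxiliary tolerance `ε₁` with `(M + 2) ε₁ < ε`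
    set ε₁ : ℝ := ε / (2 * (M + 2)) with hε₁_def
    have hε₁ : 0 < ε₁ := by positivity
    have hε₁' : (M + 2) * ε₁ = ε / 2 := by
      rw [hε₁_def]; field_simp
    -- uniform continuity of `dh` on the compact set `S`
    obtain ⟨δ₁, hδ₁, hUC⟩ := Metric.uniformContinuousOn_iff.mp
      (hS.uniformContinuousOn_of_continuous hfd) ε₁ hε₁
    refine ⟨min (δ₁ / 2) δ₂, lt_min (half_pos hδ₁) hδ₂, ?_⟩
    rintro ⟨z, w⟩ hzw hd
    obtain ⟨hz, hw⟩ := Set.mem_prod.mp hzw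
    rw [Prod.dist_eq, max_lt_iff] at hd
    obtain ⟨hdz, hdw⟩ := hd
    have hdz₁ : dist z z₀ < δ₁ / 2 := lt_of_lt_of_le hdz (min_le_left _ _)
    have hdw₁ : dist w z₀ < δ₁ / 2 := lt_of_lt_of_le hdw (min_le_left _ _)
    have hdw₂ : dist w z₀ < δ₂ := lt_of_lt_of_le hdw (min_le_right _ _)
    have hzw₁ : dist z w < δ₁ := by
      have := dist_triangle_right z w z₀
      linarith
    -- `‖dh_w 1 - dh_{z₀} 1‖ ≤ ε₁`
    have hv : ‖fderiv ℝ h w 1 - fderiv ℝ h z₀ 1‖ ≤ ε₁ := by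
      have h1 := hUC w hw z₀ hz₀ (by linarith)
      rw [dist_eq_norm] at h1
      calc ‖fderiv ℝ h w 1 - fderiv ℝ h z₀ 1‖ = ‖(fderiv ℝ h w - fderiv ℝ h z₀) 1‖ := rfl
        _ ≤ ‖fderiv ℝ h w - fderiv ℝ h z₀‖ * ‖(1 : ℂ)‖ := ContinuousLinearMap.le_opNorm _ _
        _ ≤ ε₁ := by rw [norm_one, mul_one]; exact h1.le
    rw [dist_eq_norm]
    show ‖T (z, w) - T (z₀, z₀)‖ < ε
    rw [hT z₀ z₀, if_pos rfl]
    by_cases hzw' : z = w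
    · subst hzw'
      rw [hT z z, if_pos rfl]
      have : ε₁ < ε := by nlinarith
      exact lt_of_le_of_lt hv this
    · rw [hT z w, if_neg hzw']
      -- `J`-holomorphicity at `w` with `α = 1` and `α = I`
      have hI : fderiv ℝ h w Complex.I = J (h w) (fderiv ℝ h w 1) := by
        simpa using hJh w hw 1
      have hII : J (h w) (J (h w) (fderiv ℝ h w 1)) = -fderiv ℝ h w 1 := by
        have h2 := hJh w hw Complex.I
        rw [Complex.I_mul_I, map_neg, hI] at h2
        exact h2.symm
      -- mean value inequality on the segment `[w, z] ⊆ S`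
      have hE : ‖h z - h w - fderiv ℝ h w (z - w)‖ ≤ ε₁ * ‖z - w‖ := by
        have hseg : segment ℝ w z ⊆ S := hSc.segment_subset hw hz
        have hsegb : segment ℝ w z ⊆ Metric.ball w δ₁ :=
          (convex_ball w δ₁).segment_subset (mem_ball_self hδ₁) (mem_ball.mpr hzw₁)
        exact (convex_segment w z).norm_image_sub_le_of_norm_fderiv_le'
          (fun y hy => hdiff y (hSU (hseg hy)))
          (fun y hy => by
            have h3 := hUC y (hseg hy) w hw (mem_ball.mp (hsegb hy))
            rw [dist_eq_norm] at h3
            exact h3.le)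
          (left_mem_segment ℝ w z) (right_mem_segment ℝ w z)
      have hid := helper_tdiff_continuousOn_identity (J (h w)) (fderiv ℝ h w) (z - w)
        (h z - h w) (sub_ne_zero.mpr hzw') hI hII
      have hbd := helper_tdiff_continuousOn_bound (J (h w)) (z - w)
        (h z - h w - fderiv ℝ h w (z - w)) ε₁ (sub_ne_zero.mpr hzw') hE
      rw [← hid] at hbd
      calc ‖(‖z - w‖ ^ 2)⁻¹ • ((z - w).re • (h z - h w) - (z - w).im • J (h w) (h z - h w))
              - fderiv ℝ h z₀ 1‖
          = ‖((‖z - w‖ ^ 2)⁻¹ • ((z - w).re • (h z - h w) - (z - w).im • J (h w) (h z - h w))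
              - fderiv ℝ h w 1) + (fderiv ℝ h w 1 - fderiv ℝ h z₀ 1)‖ := by
            rw [sub_add_sub_cancel]
        _ ≤ ‖(‖z - w‖ ^ 2)⁻¹ • ((z - w).re • (h z - h w) - (z - w).im • J (h w) (h z - h w))
              - fderiv ℝ h w 1‖ + ‖fderiv ℝ h w 1 - fderiv ℝ h z₀ 1‖ := norm_add_le _ _
        _ ≤ (1 + ‖J (h w)‖) * ε₁ + ε₁ := add_le_add hbd hv
        _ ≤ (1 + M) * ε₁ + ε₁ := by gcongr; exact hJb w hw hdw₂
        _ = (M + 2) * ε₁ := by ring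
        _ < ε := by rw [hε₁']; linarith

end Summit.SmoothPoincare4.SmoothPoincare4.Theorems.WitnessCharge.PencilIncompleteness
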